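import Mathlib
import HarnessLib
import HarnessLib.Audit
import Summits.CriticalPhenomena.Statement
import Literature.Probability.Percolation.CardyFormula
import HarnessLib.Audit.Status.Attr

/-!
Route: CardyMirrorMonotone

DORMANT since 2026-08-24T05:42:07Z (reconciler: no traction for 6.6 d (last activity item-evidence-added at 2026-08-17T15:24:43Z); parked, not closed — `ledger route dormant route-CriticalPhenomena-CardyMirrorMonotone --off` to reactiva) — unstaffed, not closed; items shared with open routes are served there. `ledger route dormant <id> --off` reactivates.

# Route CardyMirrorMonotone — mirror monotonicity (percolation polarization inequality) on Z2 +
PPI-augmented symmetry upgrade of every sublimit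

It suffices to show X_M = SubseqConformalInvariance: for every sequence of meshes u_n → 0⁺ there are
a subsequence and ONE
function g : ℝ → ℝ such that, along the subsequence, the P_{1/2} bond-ℤ² crossing probability of
every conformal rectangle R
converges to g(η_R), η_R the cross-ratio of any uniformizing datum (precompactness + conformal
invariance of every subsequential
limit; no uniqueness, no value). X_M → CardyFormulaZ2 through the theorem-sized crux SubseqRigidity
(g = Cardy's F along any
subsequence, by SLE₆ identification) and pure topology. The route realises card
mirror-monotonicity-ppi: X_M is to be reached from the
card's lattice conjecture MIRROR MONOTONICITY = AxisMirrorMonotone ∧ DiagMirrorMonotone (the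
percolation polarization inequality PPI:
pushing one finite plate to one side of a lattice mirror and the other plate to the other side by
Wolontis two-point rearrangement never
raises the P_{1/2}-probability that they are joined, inside any mirror-symmetric S ⊆ ℤ²), via
PolarizationTransport (PPI passes to every
subsequential two-plate limit as polarization monotonicity in the four lattice directions) and the
crux PPIConformalUpgrade.
Lean: `∀ u : ℕ → ℝ, Filter.Tendsto u Filter.atTop (nhdsWithin (0 : ℝ) (Set.Ioi 0)) → ∃ φ : ℕ → ℕ,
StrictMono φ ∧ ∃ g : ℝ → ℝ, ∀ (R : Literature.Probability.RandomPlanarGeometry.ConformalRectangle)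
(ψ : Literature.Probability.RandomPlanarGeometry.ConformalEquiv UpperHalfPlane.upperHalfPlaneSet
R.carrier) (x : Fin 4 → ℝ), R.IsUniformizing ψ x → Filter.Tendsto (fun n =>
Literature.Probability.Percolation.bondDomainCrossingProb R (u (φ n))) Filter.atTop (nhds (g
(Literature.Probability.RandomPlanarGeometry.crossRatio x)))`

## Assembly
Pure topology, PROVED sorry-free in the planner's Sketch.lean (theorem assembly_proof, 10 lines):
fix R and a uniformizing datum
(ψ, x), η = crossRatio x ∈ (0,1) by ConformalRectangle.crossRatio_mem_Ioo_of_isUniformizing; by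
Filter.tendsto_of_subseq_tendsto
(𝓝[>] 0 is countably generated) it suffices that every sequence ns → 0⁺ has a subsequence along
which bondDomainCrossingProb R → F η;
SubseqConformalInvariance gives φ, g with convergence to g η for all rectangles along ns ∘ φ,
SubseqRigidity (applied to ns ∘ φ) gives
g = F on (0,1), rewrite. The lattice cruxes feed the target through PPIConformalUpgrade (Axis → Diag
→ X_M, modus ponens).

Rationale: WHY THIS LINE. The barrier EmbeddingModulusUniqueness says an input must SEE the embedding ℤ² ⊂ ℂ;
every route in the cone consumes the dihedral
symmetry as an identity or waits for an observable, whereas this line consumes the lattice mirrors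
as an INEQUALITY: PPI is the q = 1
analogue of the Messager–Miracle-Solé inequality (MessagerMiracleSoleJSP1977, Hegerfeldt1977; FK q =
2: Häggström 2003 per
GladkovPakZimin2024 §8.5), which for percolation provably cannot come from reflection positivity
(card: a 3×3 connection kernel on the
4-cycle has negative determinant at p = 1/2) and refolds into the one planar bunkbed case
(transversal set on ONE face) untouched by
the 2024 counterexample (GladkovPakZimin2024 Thm 1.2, §8.4 "BBC for grid-like graphs is still of
interest"; Linusson (arXiv:0811.0949) Thm 3.1
outerplanar); its two-point shadow is the folklore distance-monotonicity conjecture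
(König–Richthammer (arXiv:2207.13173) Conj. 1, de Lima–Procacci–Sanchis (arXiv:1504.06549),
van den Berg–Kahn). Imported area: geometric function theory — polarization ⇒ Steiner/cap/condenser
symmetrisation
(Brock–Solynin (doi:10.1090/s0002-9947-99-02558-1) §6–7, Dubinin 1994, Baernstein 1974, Wolontis
1952): transported by RSW continuity and spread to all directions by
DKKMO2020Rotational, PPI gives every subsequential limit the classical symmetrisation calculus, an
exact ORDER axiom (lattice-exact at
every mesh, false for sheared fakes off their axes) that no symmetry-upgrade route (CardyRotToConf,
CardyScaleErgodic, CardyUniqueLimit)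
names; the negatives index (stmt-0772 only) is not touched.

RANKED CRUXES. #0 SubseqConformalInvariance (target) — X_M: every sequence of meshes tending to 0⁺
has a subsequence along which, for one g : ℝ → ℝ, the P_{1/2} bond-ℤ² crossing probability of EVERY
conformal rectangle converges to g(cross-ratio) (precompactness + conformal invariance of sublimits;
weaker than CardyUniqueLimit's X_U, stmt-0745, which adds uniqueness). (why it might fail: It is
conformal invariance of ℤ² sublimits (Schramm2007ICM Prob. 2.11; barrier EmbeddingModulusUniqueness:
no embedding-blind proof); as typed over ALL Jordan rectangles it is also hostage to the
discretisation of wild boundaries (cf. guard stmt-0748).) [Schramm2007ICM, Beffara2008Universal,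
DKKMO2020Rotational, lean:Literature.Barriers.CriticalPhenomena.EmbeddingModulusUniqueness]
#2 AxisMirrorMonotone (crux) — card K1 (PPI, axis mirrors, p = 1/2): for i ∈ {0,1}, m ∈ ℤ, the
reflection ρ(x) = x with x_i ↦ m − x_i, any S ⊆ ℤ² with ρS = S and finite plates K₀, K₁:
P_{1/2}[P⁺K₀ ↔ P⁻K₁ in S] ≤ P_{1/2}[K₀ ↔ K₁ in S], where P^±K = (K ∩ ρK) ∪ ((K ∪ ρK) ∩ H^±), H⁺ =
{2x_i ≥ m}, H⁻ = {2x_i ≤ m} (Wolontis polarization) and "↔ in S" = Literature openCrossing S.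
Singletons give the Messager–Miracle-Solé form P[a ↔ b] ≥ P[a ↔ ρb]; refolded along the mirror it is
the bunkbed inequality for the half-graph S ∩ H⁺ with transversal set on the mirror column (one
face). The natural conjecture is for all p; only p = 1/2 is load-bearing. [difficulty: open-problem]
(why it might fail: Bunkbed is false for general planar G (GPZ 2024, |T| = 3 on no common face); a
Hollom-type gadget with all transversal vertices on ONE face, or a multi-site plate straddling the
mirror (census covered plates ≤ 2 sites, boxes ≤ 24 edges), would break it.) [GladkovPakZimin2024,
Linusson2010, KonigRichthammer2025, MessagerMiracleSoleJSP1977, arXiv:2406.01790]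
#3 PPIConformalUpgrade (crux) — card plug (i)/(S): mirror monotonicity in the four lattice mirror
families implies X_M. Intended interior: PolarizationTransport (4 directions) + DKKMO rotation
invariance of sublimits (dkkmo_rotation_invariance, arXiv:2012.11672 v2 Thm 1.2 / Cor 1.4) ⇒
polarization monotonicity in ALL lines ⇒ (Brock–Solynin (doi:10.1090/s0002-9947-99-02558-1) Thm 6.1
/ Lemma 7.1, Baernstein, Dubinin) Steiner, circular and condenser symmetrisation monotonicity of
every sublimit ⇒ classification: a translation- and rotation-invariant, self-dual, FKG,
domain-Markov/local sublimit of ℤ² quad/two-plate functionals that is symmetrisation-ordered in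
every direction is Möbius-covariant (uniform-in-δ RSW equicontinuity supplies the diagonal
subsequence over a countable dense family of rectangles). [deps: AxisMirrorMonotone,
DiagMirrorMonotone, PolarizationTransport] [difficulty: open-problem] (why it might fail: Card lemma
(N): PPI + similarities alone admit non-Möbius perturbations F∘η + εh, so the classification must
consume Markov/locality/duality — no mechanism known; square-soup / MST upgrade witnesses are
untested against PPI; scale invariance of sublimits is itself open.) [DKKMO2020Rotational,
BrockSolynin1999, Beffara2008Universal, Schramm2007ICM, CamiaNewman2006]
#4 DiagMirrorMonotone (crux) — card K2 (PPI, diagonal mirrors, p = 1/2): for s = ±1, c ∈ ℤ, the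
reflection ρ(x₀,x₁) = (s x₁ + c, s (x₀ − c)) in the line x₀ − s x₁ = c, any ρ-symmetric S ⊆ ℤ² and
finite plates: P_{1/2}[P⁺K₀ ↔ P⁻K₁ in S] ≤ P_{1/2}[K₀ ↔ K₁ in S] with H⁺ = {x₀ − s x₁ ≥ c}. This is
the embedding-specific half (the diagonal reflections are exactly the inputs a stretched lattice
diag(1,λ)ℤ² lacks, barrier scope caveat (f)); refolded, the half-graph has a staircase boundary
carrying the transversal set. [difficulty: open-problem] (why it might fail: Same one-face bunkbed
risk as the axis case, with a staircase transversal arc that is not a straight dual line; no partial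
result (even small p, cf. de Lima–Procacci–Sanchis (arXiv:1504.06549) axis-only) is known in a
diagonal direction.) [GladkovPakZimin2024, Beffara2008Universal, LimaProcacciSanchis2015,
lean:Literature.Barriers.CriticalPhenomena.EmbeddingModulusUniqueness]
#5 PolarizationTransport (crux) — card K3 (S), DKKMO-free part: Axis + Diag PPI imply, for each
lattice direction θ = kπ/4 (k < 4), every offset t ∈ ℝ and all plates K₀, K₁ ⊂ ℂ that are finite
unions of compact convex sets: for every ε > 0, eventually as δ → 0⁺, P_{1/2}[(P⁺_ℓ K₀)_δ ↔ (P⁻_ℓ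
K₁)_δ] ≤ P_{1/2}[(K₀)_δ ↔ (K₁)_δ] + ε, where ℓ = {Re(z e^{-iθ}) = t}, P^± is polarization in ℂ
w.r.t. ℓ and (K)_δ = sites of ℤ² whose mesh point δx lies within δ of K (whole-plane two-plate
connection). Proof plan: nearest lattice mirror t_δ, lattice PPI for O(δ)-fattened discretised
plates, then fattening-insensitivity (boundary 3-arm, exponent 2 on flat parts, > 1 at convex
corners). Consequence (Brock–Solynin (doi:10.1090/s0002-9947-99-02558-1) §6: Steiner polarizers are
parallel to the symmetry line): Steiner monotonicity of every two-plate sublimit in the 4 lattice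
directions, slide and separation monotonicity in ℍ and strips. [deps: AxisMirrorMonotone,
DiagMirrorMonotone] [difficulty: L] (why it might fail: Needs P[(K)_{5δ} ↔ (K')_{5δ}] − P[(K)_δ ↔
(K')_δ] → 0 uniformly for convex-union plates (half-plane 3-arm bounds near flat parts and corners,
unproved on bond-ℤ² in this form) and Hausdorff-continuity of t ↦ P_t K; may fail as typed at
degenerate offsets.) [BrockSolynin1999, GrimmettPercolation1999, Nolin2008, SmirnovWerner2001,
lean:Literature.Probability.Percolation.rsw_half]
#6 SubseqRigidity (crux) — Cardy rigidity along subsequences: if u_n → 0⁺ and the crossing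
probabilities of ALL conformal rectangles converge along u_n to g(cross-ratio), then g =
cardyFunction on (0,1). Subsequential strengthening of the shared crux CardyRigidity
(stmt-CriticalPhenomena-0746; same intended proof: hitting kernel g + AB tightness
isTightLaws_map_bondInterface + RSW ⇒ exploration sublimit is a conformally invariant domain-Markov
curve = SLE_κ, locality ⇒ κ = 6 (eq_six_of_forall_measureReal_hitsBefore),
sle_six_measureReal_hitsBefore ⇒ g = F); it implies 0746 trivially. [difficulty: XL] (why it might
fail: As for stmt-0746: CamiaNewman2007 Thms 2–3 need crossing kernels in admissible NON-Jordan
domains with moving mesh, while the hypothesis here has fixed Jordan rectangles only; false only if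
a conformally invariant non-Cardy sublimit exists.) [CamiaNewman2007, Smirnov2001, Schramm2000,
LawlerSchrammWerner2001, Werner2007, KemppainenSmirnov2017]
#9 TwoPointMirror (support) — the two-point (MMS / van den Berg–Kahn) shadow of AxisMirrorMonotone
in the whole plane at p = 1/2: for a, b on the closed right side of the vertical mirror x₀ = m/2,
P[a ↔ ρb] ≤ P[a ↔ b]. Equivalent to König–Richthammer (arXiv:2207.13173) Conjecture 1 for d = 2 at p
= 1/2 (two-point function monotone in the componentwise order; open, "folklore"; only small-p axis
case known, de Lima–Procacci–Sanchis (arXiv:1504.06549)); cheapest sub-target and the object of the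
cheapest falsifier. [difficulty: open-problem] [KonigRichthammer2025, LimaProcacciSanchis2015,
GladkovPakZimin2024]
#9 SlideMonotone (support) — slide monotonicity in the discrete upper half-plane, provable now from
AxisMirrorMonotone: for integers b < c ≤ d, sliding the boundary interval [c,d]×{0} one step away
from [a,b]×{0} does not raise the P_{1/2}-probability of an open connection inside {x₁ ≥ 0}
(instance i = 0, m = c + d + 1, K₀ = [c,d]×{0}, K₁ = [a,b]×{0}: P⁺K₀ = [c+1,d+1]×{0}, P⁻K₁ = K₁ —
checked by hand). First rung of the symmetrisation calculus (card (S4)). [difficulty: provable-now]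
[BrockSolynin1999, KonigRichthammer2025]

TWO-LAYER PLAN. Foreseen glued splits (none filed now): PPIConformalUpgrade ⇐ AllDirections →
Classification → PPIConformalUpgrade, where AllDirections =
"PolarizationTransport's conclusion for every θ ∈ ℝ" (glue: dkkmo_rotation_invariance-type rotation
invariance of two-plate sublimits +
the 4-direction transport) and Classification = "rotation-invariant, self-dual, Markov/local,
all-direction polarization-ordered sublimit
family ⇒ X_M"; AxisMirrorMonotone ⇐ EdgeMirror (m odd: Linusson's model with Bernoulli posts) →
SiteMirror (m even: posts ≡ 1) glue by
cases; PolarizationTransport ⇐ FatteningContinuity (3-arm) → LatticeToContinuum →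
PolarizationTransport.

KILL CRITERIA. ¬AxisMirrorMonotone (one symmetric S, one plate pair, exact enumeration at p = 1/2)
closes the route `refuted:AxisMirrorMonotone` and
retires the card's mechanism; ¬DiagMirrorMonotone alone forces a pivot to the blind half (axis PPI
as a tool for slide/Steiner
monotonicity only — no Cardy route remains, close). ¬PPIConformalUpgrade (a rotation-invariant,
Markov, self-dual, PPI-ordered
non-conformal sublimit family, e.g. a square-soup witness passing PPI) closes the route while PPI
survives as a Literature-worthy
conjecture. ¬SubseqConformalInvariance with CardyFormulaZ2 true is impossible; X_U (stmt-0745) or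
SLE6LimitZ2 proved elsewhere moots
the route (its lattice cruxes keep independent value).

NOT DECOMPOSED YET. The interior of PPIConformalUpgrade (rotation spread via DKKMO,
Brock–Solynin/Baernstein limits of polarizations for two-plate
functionals, the classification statement and which structure — duality, Markov, FKG, noise
factorisation — it consumes); the
refolding lemma (fold ℤ² along the mirror = two i.i.d. percolations on the half-graph glued on the
mirror column) and the |T| ≤ 2 /
outerplanar-type sub-cases of AxisMirrorMonotone; the fattening-continuity lemma inside
PolarizationTransport; the CamiaNewman
skeleton of SubseqRigidity (shared with stmt-0746). All are layer-2 children once a crux moves.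

CHEAPEST FALSIFIER. Exact enumeration at p = 1/2 (or as integer polynomials in p) of D = P[K₀ ↔ K₁
in S] − P[P⁺K₀ ↔ P⁻K₁ in S] over all plate pairs in
mirror-symmetric boxes with ≤ 24 edges, now INCLUDING plates of 3–4 sites straddling the mirror and
symmetric S with holes; the card's
census (8 555 + 6 144 polynomials, plates ≤ 2 sites, boxes/cylinders ≤ 24 edges, 700+ random
symmetric planar subgraphs) found zero sign
changes on (0,1). Second: transfer-matrix P at p = 1/2 on 9×5 and Monte Carlo for τ((n,0)) −
τ((n+1,0)), n ≤ 64 (TwoPointMirror).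
Lookup run this session: no planar one-face bunkbed counterexample in arXiv:2410.02545, 2406.01790,
2506.09264, 2410.08957, 2509.18788.

NUMBERS. Bunkbed status (sources read): false for a planar G with 7222 vertices, |T| = 3
(GladkovPakZimin2024 Thm 1.2); true for outerplanar G,
all T (Linusson (arXiv:0811.0949) Thm 3.1), complete and complete bipartite graphs, p ↑ 1
(arXiv:2110.00282), p ↓ 0 two-point axis monotonicity on ℤ^d
(de Lima–Procacci–Sanchis (arXiv:1504.06549)), FK q = 2 (Häggström 2003). Card census: 8 555 + 6 144
exact polynomials, 0 violations. Items at open: 9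
(1 target, 5 cruxes, 2 support, 1 assembly).

DEFINITION REQUESTS. SetPolarization (Wolontis/Brock–Solynin two-point rearrangement P_H K = (K ∩
ρK) ∪ ((K ∪ ρK) ∩ H) of a set w.r.t. a closed half-plane
H ⊂ ℂ with reflection ρ, and its lattice version for a reflection of Site 2) — would shorten
AxisMirrorMonotone, DiagMirrorMonotone and
PolarizationTransport, which inline it; to be filed with `ledger workitem add --kind definition` for
the PolarizationTransport item.
No cite facts wanted beyond the tree's dkkmo_rotation_invariance.

Novelty: Searches (2026-08-15, this session, on top of the card's): lit search --source all "bunkbed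
conjecture percolation" (15 local + 24
remote; new: arXiv:2509.18788, 2506.09264, 2410.08957, 2511.13589, 2204.12931, 2207.13173); lit read
arXiv:2410.02545 §8.3–8.5,
arXiv:0811.0949 §3, arXiv:2207.13173 §1–2, doi:10.1090/s0002-9947-99-02558-1 §6–7 (pages quoted in
the items); lit frontier
CriticalPhenomena --since 2023 (30, none on correlation/rearrangement inequalities for ℤ²); lit
galaxy search --star all
"symmetrization inequality for percolation connection probabilities" (0), "monotonicity of the
two-point function of percolation in the
distance" (0), "polarization inequality" (6, none percolation), "two-point function is monotone"
(0); ledger idea list (35 routed cards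
of the sub, none on polarization); grep of the 33 Theses files (only CardyExpCovariance's
ReflectionSymmetry identity).
Nearest prior art found: König–Richthammer (arXiv:2207.13173) (doi:10.1016/j.spa.2024.104549) Conj.
1/3 + Prop. 1 (two-point distance monotonicity
on ℤ^d and layered graphs; BBC ⇒ layered ⇒ ℤ^d) and GladkovPakZimin2024 §8.4 — the POINT-TO-POINT
axis shadow of AxisMirrorMonotone,
posed, open; MessagerMiracleSoleJSP1977 (the Ising inequality); Brock–Solynin
(doi:10.1090/s0002-9947-99-02558-1) (polarization ⇒ symmetrisation for capacities /
BVPs); symmetry-upgrade routes CardyRotToConf / CardyScaleErgodic (upgrade without an order axiom).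
Delta: plate-to-plate polarization ORDER inside arbitrary mirr  [refs: 10.1090/s0002-9947-99-02558-1, 10.1016/j.spa.2024.104549, 2509.18788, 2410.02545, 0811.0949, 2207.13173, doi:10.1090/s0002-9947-99-02558-1, doi:10.1016/j.spa.2024.104549, GladkovPakZimin2024, MessagerMiracleSoleJSP1977]

Barriers (technique_class: rearrangement-inequality polarization symmetry-upgrade): - technique_class: rearrangement-inequality polarization symmetry-upgrade
- Literature.Barriers.CriticalPhenomena.EmbeddingModulusUniqueness: APPLIES to the target X_M and to
PPIConformalUpgrade's conclusion (conformal invariance of sublimits); evaded as the barrier's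
evasion (i): AxisMirrorMonotone is inside the blind class (shared by diag(1,λ)ℤ², scope caveat (f))
and is used only for axis-direction Steiner/slide monotonicity, while DiagMirrorMonotone (the
diagonal reflections, named in caveat (f) as the cheapest distinguishing input) and DKKMO rotation
invariance inside PPIConformalUpgrade are embedding-specific; the lattice cruxes themselves assert
no invariance and are not blocked.
- Literature.Barriers.CriticalPhenomena.ScaleCovarianceNotMoebius: APPLIES in spirit to
PPIConformalUpgrade (its class `symmetry-upgrade`: Euclidean + scale symmetry data alone never give
Möbius covariance — the barrier's witness is a bare correlation family carrying no correlation
inequalities, scope caveat (a)); the line's extra input is exactly of the kind caveat (a) exempts: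
an ORDER axiom (PPI = a family of correlation-type inequalities, lattice-exact) plus the
Markov/locality/self-duality of genuine percolation sublimits; honest limit: it does not evade it by
PPI alone — card lemma (N) shows PPI + similarities admit non-Möbius perturbations, so the bet is
that PPI-order together with the lattice-inherited structure excludes the witnesses (refuter target:
square-soup / MST families agains

History (route lifecycle, newest last):
- 2026-08-15T12:40:34Z · rev 1: restated PPIConformalUpgrade (stmt-CriticalPhenomena-8268) — materialise PPIConformalUpgrade: the gate orders items by rank, so the rank-3 decl cannot name the rank-4 decl DiagMirrorMonotone; restated 1:1 with the DiagMir (planner-plancard-CriticalPhenomena-CardyFormu-0f57cb4b-0)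
- 2026-08-16T02:18:23Z · AUTO-CRUX: 2 conjecture-grade item(s) promoted to crux (TwoPointMirror, SLE6ChordalCurve) — refuter vetting / tiering apply (operator:999:1362873)
- 2026-08-16T03:50:11Z · AUTO-CRUX (backfill): SubseqConformalInvariance — hypotheses of the deciding theorem that nothing in the route derives are cruxes (operator:999:586464)
- 2026-08-24T05:42:07Z · DORMANT — reconciler: no traction for 6.6 d (last activity item-evidence-added at 2026-08-17T15:24:43Z); parked, not closed — `ledger route dormant route-CriticalPhenomen (operator:999:3422275)

sub-problem: CardyFormulaZ2 · status: dormant · opened planner-plancard-CriticalPhenomena-CardyFormu-0f57cb4b-0 2026-08-15T12:36:06Z · rev 5 · ledger route-CriticalPhenomena-CardyMirrorMonotone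
GENERATED by the gate from the ledger (D-0016/17). Provers cite these decls: `theorem foo : Summit.CriticalPhenomena.CardyFormulaZ2.Theses.CardyMirrorMonotone.<Decl> := …` in Summits/CriticalPhenomena/CardyFormulaZ2/Theorems/<Name>.lean.
-/

namespace Summit.CriticalPhenomena.CardyFormulaZ2.Theses.CardyMirrorMonotone

open scoped BigOperators Topology Manifold Classical MeasureTheory ProbabilityTheory Matrix InnerProductSpace ComplexConjugate ContinuousMap
open Filter Set Function TopologicalSpace MeasureTheory

attribute [summit_statement] _root_.CardyFormulaZ2

/-- item stmt-CriticalPhenomena-8266 · crux (kind.auto-crux: conjecture-grade) · rank 0 · open · by planner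
why it might fail: It IS conformal invariance of bond-ℤ² crossing sublimits — Schramm2007ICM Problem 2.11, open since Smirnov2001; EmbeddingModulusUniqueness: no embedding-blind argument reaches it; typed over ALL marked Jordan domains, so non-rectifiable boundaries and their arc discretisation are in scope too.
sources: Schramm2007ICM, Smirnov2001, Beffara2008Universal, DKKMO2020Rotational, lean:Literature.Barriers.CriticalPhenomena.EmbeddingModulusUniqueness
[target] X_M: every sequence of meshes tending to 0⁺ has a subsequence along which, for one g : ℝ →
ℝ, the P_{1/2} bond-ℤ² crossing probability of EVERY conformal rectangle converges to g(cross-ratio)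
(precompactness + conformal invariance of sublimits; weaker than CardyUniqueLimit's X_U, stmt-0745,
which adds uniqueness). -/
@[route_item "route-CriticalPhenomena-CardyMirrorMonotone", crux]
def SubseqConformalInvariance : Prop :=
  ∀ u : ℕ → ℝ, Filter.Tendsto u Filter.atTop (nhdsWithin (0 : ℝ) (Set.Ioi 0)) → ∃ φ : ℕ → ℕ, StrictMono φ ∧ ∃ g : ℝ → ℝ, ∀ (R : Literature.Probability.RandomPlanarGeometry.ConformalRectangle) (ψ : Literature.Probability.RandomPlanarGeometry.ConformalEquiv UpperHalfPlane.upperHalfPlaneSet R.carrier) (x : Fin 4 → ℝ), R.IsUniformizing ψ x → Filter.Tendsto (fun n => Literature.Probability.Percolation.bondDomainCrossingProb R (u (φ n))) Filter.atTop (nhds (g (Literature.Probability.RandomPlanarGeometry.crossRatio x)))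

/-- item stmt-CriticalPhenomena-8267 · crux · rank 2 · open · by planner
why it might fail: Bunkbed-type: BBC is false for a planar graph (GladkovPakZimin2024 Thm 1.2, |T|=3), proved only for |T|≤2, outerplanar (Linusson2010 Thm 3.1), cacti; the fold gives ARBITRARY induced half-lattice graphs with holes, T on one face: a Hollom gadget cut out of ℤ² or a plate astride the mirror may fail.
sources: GladkovPakZimin2024, Linusson2010, arXiv:2406.01790, arXiv:2506.09264, KonigRichthammer2025, MessagerMiracleSoleJSP1977
[crux] card K1 (PPI, axis mirrors, p = 1/2): for i ∈ {0,1}, m ∈ ℤ, the reflection ρ(x) = x with x_i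
↦ m − x_i, any S ⊆ ℤ² with ρS = S and finite plates K₀, K₁: P_{1/2}[P⁺K₀ ↔ P⁻K₁ in S] ≤ P_{1/2}[K₀ ↔
K₁ in S], where P^±K = (K ∩ ρK) ∪ ((K ∪ ρK) ∩ H^±), H⁺ = {2x_i ≥ m}, H⁻ = {2x_i ≤ m} (Wolontis
polarization) and "↔ in S" = Literature openCrossing S. Singletons give the Messager–Miracle-Solé
form P[a ↔ b] ≥ P[a ↔ ρb]; refolded along the mirror it is the bunkbed inequality for the half-graph
S ∩ H⁺ with transversal set on the mirror column (one face). The natural conjecture is for all p;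
only p = 1/2 is load-bearing. [difficulty: open-problem] -/
@[route_item "route-CriticalPhenomena-CardyMirrorMonotone"]
def AxisMirrorMonotone : Prop :=
  ∀ (i : Fin 2) (m : ℤ) (S K₀ K₁ : Set (Literature.Probability.LatticeModels.Site 2)), K₀.Finite → K₁.Finite → (∀ x, x ∈ S ↔ Function.update x i (m - x i) ∈ S) → (Literature.Probability.Percolation.bondPercolation (Literature.Probability.LatticeModels.zdGraph 2) Literature.Probability.Percolation.half).real (Literature.Probability.Percolation.openCrossing S {x | (x ∈ K₀ ∧ Function.update x i (m - x i) ∈ K₀) ∨ ((x ∈ K₀ ∨ Function.update x i (m - x i) ∈ K₀) ∧ m ≤ 2 * x i)} {x | (x ∈ K₁ ∧ Function.update x i (m - x i) ∈ K₁) ∨ ((x ∈ K₁ ∨ Function.update x i (m - x i) ∈ K₁) ∧ 2 * x i ≤ m)}) ≤ (Literature.Probability.Percolation.bondPercolation (Literature.Probability.LatticeModels.zdGraph 2) Literature.Probability.Percolation.half).real (Literature.Probability.Percolation.openCrossing S K₀ K₁)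

-- earlier PPIConformalUpgrade (stmt-CriticalPhenomena-8268, replaced 2026-08-15T12:40:34Z -> stmt-CriticalPhenomena-8349): retired by None — AxisMirrorMonotone → DiagMirrorMonotone → SubseqConformalInvariance
/-- item stmt-CriticalPhenomena-8349 · crux · rank 3 · open · by planner
why it might fail: Nothing known turns symmetrisation ORDER into Möbius covariance: ScaleCovarianceNotMoebius has rotation+scale-covariant non-Möbius kernels, card lemma (N) perturbations F∘η+εh keep polarization order, so Markov/self-duality must enter by an unknown mechanism; scale invariance of sublimits is open.
sources: lean:Literature.Barriers.CriticalPhenomena.ScaleCovarianceNotMoebius, DKKMO2020Rotational, BrockSolynin1999, Schramm2007ICM, CamiaNewman2006, Beffara2008Universal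
[crux] card plug (i)/(S): mirror monotonicity in the four lattice mirror families implies X_M.
Intended interior: PolarizationTransport (4 directions) + DKKMO rotation invariance of sublimits
(dkkmo_rotation_invariance, arXiv:2012.11672 v2 Thm 1.2 / Cor 1.4) ⇒ polarization monotonicity in
ALL lines ⇒ (Brock–Solynin (doi:10.1090/s0002-9947-99-02558-1) Thm 6.1 / Lemma 7.1, Baernstein,
Dubinin) Steiner, circular and condenser symmetrisation monotonicity of every sublimit ⇒
classification: a translation- and rotation-invariant, self-dual, FKG, domain-Markov/local sublimit
of ℤ² quad/two-plate functionals that is symmetrisation-ordered in every direction is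
Möbius-covariant (uniform-in-δ RSW equicontinuity supplies the diagonal subsequence over a countable
dense family of rectangles). [deps: AxisMirrorMonotone, DiagMirrorMonotone, PolarizationTransport]
[difficulty: open-problem] -/
@[route_item "route-CriticalPhenomena-CardyMirrorMonotone"]
def PPIConformalUpgrade : Prop :=
  AxisMirrorMonotone → (∀ (s : ℤ), (s = 1 ∨ s = -1) → ∀ (c : ℤ) (S K₀ K₁ : Set (Literature.Probability.LatticeModels.Site 2)), K₀.Finite → K₁.Finite → (∀ x : Literature.Probability.LatticeModels.Site 2, x ∈ S ↔ (![s * x 1 + c, s * (x 0 - c)] : Literature.Probability.LatticeModels.Site 2) ∈ S) → (Literature.Probability.Percolation.bondPercolation (Literature.Probability.LatticeModels.zdGraph 2) Literature.Probability.Percolation.half).real (Literature.Probability.Percolation.openCrossing S {x | (x ∈ K₀ ∧ (![s * x 1 + c, s * (x 0 - c)] : Literature.Probability.LatticeModels.Site 2) ∈ K₀) ∨ ((x ∈ K₀ ∨ (![s * x 1 + c, s * (x 0 - c)] : Literature.Probability.LatticeModels.Site 2) ∈ K₀) ∧ c ≤ x 0 - s * x 1)} {x | (x ∈ K₁ ∧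 (![s * x 1 + c, s * (x 0 - c)] : Literature.Probability.LatticeModels.Site 2) ∈ K₁) ∨ ((x ∈ K₁ ∨ (![s * x 1 + c, s * (x 0 - c)] : Literature.Probability.LatticeModels.Site 2) ∈ K₁) ∧ x 0 - s * x 1 ≤ c)}) ≤ (Literature.Probability.Percolation.bondPercolation (Literature.Probability.LatticeModels.zdGraph 2) Literature.Probability.Percolation.half).real (Literature.Probability.Percolation.openCrossing S K₀ K₁)) → SubseqConformalInvariance

/-- item stmt-CriticalPhenomena-8269 · crux · rank 4 · open · by planner
why it might fail: Same one-face bunkbed exposure as the axis case (GladkovPakZimin2024 Thm 1.2; only |T|≤2, outerplanar proved) with a staircase mirror: T sits on a zig-zag boundary of the folded half-graph; all partial results (LimaProcacciSanchis2015 small p, KonigRichthammer2025 layered) are axis-directional.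
sources: GladkovPakZimin2024, Linusson2010, LimaProcacciSanchis2015, KonigRichthammer2025, lean:Literature.Barriers.CriticalPhenomena.EmbeddingModulusUniqueness
[crux] card K2 (PPI, diagonal mirrors, p = 1/2): for s = ±1, c ∈ ℤ, the reflection ρ(x₀,x₁) = (s x₁
+ c, s (x₀ − c)) in the line x₀ − s x₁ = c, any ρ-symmetric S ⊆ ℤ² and finite plates: P_{1/2}[P⁺K₀ ↔
P⁻K₁ in S] ≤ P_{1/2}[K₀ ↔ K₁ in S] with H⁺ = {x₀ − s x₁ ≥ c}. This is the embedding-specific half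
(the diagonal reflections are exactly the inputs a stretched lattice diag(1,λ)ℤ² lacks, barrier
scope caveat (f)); refolded, the half-graph has a staircase boundary carrying the transversal set.
[difficulty: open-problem] -/
@[route_item "route-CriticalPhenomena-CardyMirrorMonotone"]
def DiagMirrorMonotone : Prop :=
  ∀ (s : ℤ), (s = 1 ∨ s = -1) → ∀ (c : ℤ) (S K₀ K₁ : Set (Literature.Probability.LatticeModels.Site 2)), K₀.Finite → K₁.Finite → (∀ x : Literature.Probability.LatticeModels.Site 2, x ∈ S ↔ (![s * x 1 + c, s * (x 0 - c)] : Literature.Probability.LatticeModels.Site 2) ∈ S) → (Literature.Probability.Percolation.bondPercolation (Literature.Probability.LatticeModels.zdGraph 2) Literature.Probability.Percolation.half).real (Literature.Probability.Percolation.openCrossing S {x | (x ∈ K₀ ∧ (![s * x 1 + c, s * (x 0 - c)] : Literature.Probability.LatticeModels.Site 2) ∈ K₀) ∨ ((x ∈ K₀ ∨ (![s * x 1 + c, s * (x 0 - c)] : Literature.Probability.LatticeModels.Site 2) ∈ K₀) ∧ c ≤ x 0 - s * x 1)} {x | (x ∈ K₁ ∧ (![s * x 1 + c, s * (x 0 -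 c)] : Literature.Probability.LatticeModels.Site 2) ∈ K₁) ∨ ((x ∈ K₁ ∨ (![s * x 1 + c, s * (x 0 - c)] : Literature.Probability.LatticeModels.Site 2) ∈ K₁) ∧ x 0 - s * x 1 ≤ c)}) ≤ (Literature.Probability.Percolation.bondPercolation (Literature.Probability.LatticeModels.zdGraph 2) Literature.Probability.Percolation.half).real (Literature.Probability.Percolation.openCrossing S K₀ K₁)

/-- item stmt-CriticalPhenomena-8271 · crux · rank 6 · open · by planner
why it might fail: Printed SLE₆ identifications use F itself and crossing limits in admissible NON-Jordan domains with moving mesh (CamiaNewman2007 Thm 3, Rem 5.4; BinderChayesLei2010); from fixed Jordan rectangles and unknown g one must re-sandwich, run Schramm's characterisation on a g-determined sublimit, fix κ=6.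
sources: CamiaNewman2007, BinderChayesLei2010, Smirnov2001, Schramm2000, LawlerSchrammWerner2001, KemppainenSmirnov2017
[crux] Cardy rigidity along subsequences: if u_n → 0⁺ and the crossing probabilities of ALL
conformal rectangles converge along u_n to g(cross-ratio), then g = cardyFunction on (0,1).
Subsequential strengthening of the shared crux CardyRigidity (stmt-CriticalPhenomena-0746; same
intended proof: hitting kernel g + AB tightness isTightLaws_map_bondInterface + RSW ⇒ exploration
sublimit is a conformally invariant domain-Markov curve = SLE_κ, locality ⇒ κ = 6
(eq_six_of_forall_measureReal_hitsBefore), sle_six_measureReal_hitsBefore ⇒ g = F); it implies 0746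
trivially. [difficulty: XL] -/
@[route_item "route-CriticalPhenomena-CardyMirrorMonotone", crux]
def SubseqRigidity : Prop :=
  ∀ u : ℕ → ℝ, Filter.Tendsto u Filter.atTop (nhdsWithin (0 : ℝ) (Set.Ioi 0)) → ∀ g : ℝ → ℝ, (∀ (R : Literature.Probability.RandomPlanarGeometry.ConformalRectangle) (ψ : Literature.Probability.RandomPlanarGeometry.ConformalEquiv UpperHalfPlane.upperHalfPlaneSet R.carrier) (x : Fin 4 → ℝ), R.IsUniformizing ψ x → Filter.Tendsto (fun n => Literature.Probability.Percolation.bondDomainCrossingProb R (u n)) Filter.atTop (nhds (g (Literature.Probability.RandomPlanarGeometry.crossRatio x)))) → Set.EqOn g Literature.Probability.RandomPlanarGeometry.cardyFunction (Set.Ioo 0 1)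

/-- item stmt-CriticalPhenomena-8272 · crux (kind.auto-crux: conjecture-grade) · rank 9 · open · by planner
why it might fail: auto-crux — conjecture-grade statement (docstring avows it ('Conjecture')); it is open, so it may simply be false
sources: KonigRichthammer2025, LimaProcacciSanchis2015, GladkovPakZimin2024
[support] the two-point (MMS / van den Berg–Kahn) shadow of AxisMirrorMonotone in the whole plane at
p = 1/2: for a, b on the closed right side of the vertical mirror x₀ = m/2, P[a ↔ ρb] ≤ P[a ↔ b].
Equivalent to König–Richthammer (arXiv:2207.13173) Conjecture 1 for d = 2 at p = 1/2 (two-point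
function monotone in the componentwise order; open, "folklore"; only small-p axis case known, de
Lima–Procacci–Sanchis (arXiv:1504.06549)); cheapest sub-target and the object of the cheapest
falsifier. [difficulty: open-problem] -/
@[route_item "route-CriticalPhenomena-CardyMirrorMonotone"]
def TwoPointMirror : Prop :=
  ∀ (m : ℤ) (a b : Literature.Probability.LatticeModels.Site 2), m ≤ 2 * a 0 → m ≤ 2 * b 0 → (Literature.Probability.Percolation.bondPercolation (Literature.Probability.LatticeModels.zdGraph 2) Literature.Probability.Percolation.half).real (Literature.Probability.Percolation.openCrossing Set.univ {a} {Function.update b 0 (m - b 0)}) ≤ (Literature.Probability.Percolation.bondPercolation (Literature.Probability.LatticeModels.zdGraph 2) Literature.Probability.Percolation.half).real (Literature.Probability.Percolation.openCrossing Set.univ {a} {b})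

/-- item stmt-CriticalPhenomena-8498 · crux (kind.auto-crux: conjecture-grade) · rank 9 · open · by planner
why it might fail: auto-crux — conjecture-grade statement (docstring avows it ('conjecture')); it is open, so it may simply be false
sources: conjecture-registry
[support] needs-fact marker (route-repair cone triage 2026-08-15): chordal SLE₆ exists as a random
continuous curve in every Dobrushin domain — the κ = 6 instance of the only two unproved cone facts
the theses use, needs-fact: Literature.Probability.RandomPlanarGeometry.exists_isSLECurve and
needs-fact: Literature.Probability.RandomPlanarGeometry.tendsto_norm_sleTrace_atTop
(RohdeSchramm2005 Thm 5.1 + Thm 7.1, Lawler2005 §6.3), consumed only inside the rank-6 crux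
SubseqRigidity (non-vacuity of IsSLELaw 6 in sle_six_measureReal_hitsBefore_holds; law uniqueness
IsSLECurve.map_eq_holds is discharged). One line from exists_isSLECurve_holds when it lands (planner
Sketch.lean: fun D => h (by norm_num) D); directly: hasSLETrace_of_ne_eight_holds (6 ≠ 8) +
transience of the SLE₆ trace + Carathéodory boundary extension (discharged) — decoupled from the κ =
8 case (hasSLETrace_eight) that holds the all-κ facts hostage. The other 14 unproved cone facts (the
6 conjecture statements incl. the target CardyFormulaZ2; FitznerVanDerHofstad2017_beta_eq_one,
hasSLETrace_eight, HasSLETrace, gm_boxCrossingBounds_uniform, gm_boxCrossing,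
gm_theta_critical_eq_zero, gm_universality_oneArm, gm_universalit -/
@[route_item "route-CriticalPhenomena-CardyMirrorMonotone"]
def SLE6ChordalCurve : Prop :=
  ∀ D : Literature.Probability.RandomPlanarGeometry.DobrushinDomain, ∃ Γ : (NNReal → ℝ) → Literature.Probability.RandomPlanarGeometry.CurveClass ℂ, Literature.Probability.RandomPlanarGeometry.IsSLECurve 6 D Γ

/-- item stmt-CriticalPhenomena-8270 · support · rank 5 · open · by planner
why it might fail: Needs P[(K)_{5δ} ↔ (K')_{5δ}] − P[(K)_δ ↔ (K')_δ] → 0 uniformly for convex-union plates (half-plane 3-arm bounds near flat parts and corners, unproved on bond-ℤ² in this form) and Hausdorff-continuity of t ↦ P_t K; may fail as typed at degenerate offsets.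
sources: BrockSolynin1999, Nolin2008, LawlerSchrammWernerEJP2002, GrimmettPercolation1999, lean:Literature.Probability.Percolation.LawlerSchrammWerner2002_halfPlane_threeArm, lean:Literature.Probability.Percolation.rsw_half
[crux] card K3 (S), DKKMO-free part: Axis + Diag PPI imply, for each lattice direction θ = kπ/4 (k <
4), every offset t ∈ ℝ and all plates K₀, K₁ ⊂ ℂ that are finite unions of compact convex sets: for
every ε > 0, eventually as δ → 0⁺, P_{1/2}[(P⁺_ℓ K₀)_δ ↔ (P⁻_ℓ K₁)_δ] ≤ P_{1/2}[(K₀)_δ ↔ (K₁)_δ] +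
ε, where ℓ = {Re(z e^{-iθ}) = t}, P^± is polarization in ℂ w.r.t. ℓ and (K)_δ = sites of ℤ² whose
mesh point δx lies within δ of K (whole-plane two-plate connection). Proof plan: nearest lattice
mirror t_δ, lattice PPI for O(δ)-fattened discretised plates, then fattening-insensitivity (boundary
3-arm, exponent 2 on flat parts, > 1 at convex corners). Consequence (Brock–Solynin
(doi:10.1090/s0002-9947-99-02558-1) §6: Steiner polarizers are parallel to the symmetry line):
Steiner monotonicity of every two-plate sublimit in the 4 lattice directions, slide and separation
monotonicity in ℍ and strips. [deps: AxisMirrorMonotone, DiagMirrorMonotone] [difficulty: L] -/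
@[route_item "route-CriticalPhenomena-CardyMirrorMonotone"]
def PolarizationTransport : Prop :=
  AxisMirrorMonotone → DiagMirrorMonotone → ∀ (k : ℕ), k < 4 → ∀ (t : ℝ) (K₀ K₁ : Set ℂ), (∃ (n : ℕ) (C : Fin n → Set ℂ), (∀ j, IsCompact (C j) ∧ Convex ℝ (C j)) ∧ K₀ = ⋃ j, C j) → (∃ (n : ℕ) (C : Fin n → Set ℂ), (∀ j, IsCompact (C j) ∧ Convex ℝ (C j)) ∧ K₁ = ⋃ j, C j) → ∀ ε : ℝ, 0 < ε → ∀ᶠ δ in nhdsWithin (0 : ℝ) (Set.Ioi 0), let w : ℂ := Complex.exp ((((k : ℝ) * (Real.pi / 4) : ℝ) : ℂ) * Complex.I); let σ : ℂ → ℝ := fun z => (z * (starRingEnd ℂ) w).re; let ρ : ℂ → ℂ := fun z => z - (((2 * (σ z - t) : ℝ)) : ℂ) * w; let P : Set ℂ → Set ℂ → ℝ := fun A B => (Literature.Probability.Percolation.bondPercolation (Literature.Probability.LatticeModels.zdGraph 2) Literature.Probability.Percolation.half).real (Literature.Probability.Percolation.openCrossing Set.univ {x : Literature.Probability.LatticeModels.Site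 2 | ∃ a ∈ A, dist (Literature.Probability.LatticeModels.meshPoint δ x) a ≤ δ} {x : Literature.Probability.LatticeModels.Site 2 | ∃ b ∈ B, dist (Literature.Probability.LatticeModels.meshPoint δ x) b ≤ δ}); P {z | (z ∈ K₀ ∧ ρ z ∈ K₀) ∨ ((z ∈ K₀ ∨ ρ z ∈ K₀) ∧ t ≤ σ z)} {z | (z ∈ K₁ ∧ ρ z ∈ K₁) ∨ ((z ∈ K₁ ∨ ρ z ∈ K₁) ∧ σ z ≤ t)} ≤ P K₀ K₁ + ε

/-- item stmt-CriticalPhenomena-8273 · support · rank 9 · open · by planner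
sources: BrockSolynin1999, KonigRichthammer2025
[support] slide monotonicity in the discrete upper half-plane, provable now from AxisMirrorMonotone:
for integers b < c ≤ d, sliding the boundary interval [c,d]×{0} one step away from [a,b]×{0} does
not raise the P_{1/2}-probability of an open connection inside {x₁ ≥ 0} (instance i = 0, m = c + d +
1, K₀ = [c,d]×{0}, K₁ = [a,b]×{0}: P⁺K₀ = [c+1,d+1]×{0}, P⁻K₁ = K₁ — checked by hand). First rung of
the symmetrisation calculus (card (S4)). [difficulty: provable-now] -/
@[route_item "route-CriticalPhenomena-CardyMirrorMonotone"]
def SlideMonotone : Prop :=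
  AxisMirrorMonotone → ∀ (a b c d : ℤ), b < c → c ≤ d → (Literature.Probability.Percolation.bondPercolation (Literature.Probability.LatticeModels.zdGraph 2) Literature.Probability.Percolation.half).real (Literature.Probability.Percolation.openCrossing {x : Literature.Probability.LatticeModels.Site 2 | 0 ≤ x 1} {x | x 1 = 0 ∧ c + 1 ≤ x 0 ∧ x 0 ≤ d + 1} {x | x 1 = 0 ∧ a ≤ x 0 ∧ x 0 ≤ b}) ≤ (Literature.Probability.Percolation.bondPercolation (Literature.Probability.LatticeModels.zdGraph 2) Literature.Probability.Percolation.half).real (Literature.Probability.Percolation.openCrossing {x : Literature.Probability.LatticeModels.Site 2 | 0 ≤ x 1} {x | x 1 = 0 ∧ c ≤ x 0 ∧ x 0 ≤ d} {x | x 1 = 0 ∧ a ≤ x 0 ∧ x 0 ≤ b})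

/-- item stmt-CriticalPhenomena-8274 · assembly · rank 1 · open · by planner
sources: Smirnov2001, CamiaNewman2007
[assembly] SubseqConformalInvariance → SubseqRigidity → CardyFormulaZ2 (and X_M itself ⇐
AxisMirrorMonotone → DiagMirrorMonotone → PPIConformalUpgrade). -/
@[route_item "route-CriticalPhenomena-CardyMirrorMonotone", crux]
def Assembly : Prop :=
  SubseqConformalInvariance → SubseqRigidity → CardyFormulaZ2

/-! D-0027 §2.1 — DECIDING THEOREM (planner-authored via `route open/edit --closes-file`; by planner-rrepair-CriticalPhenomena-CardyMirrorM-71a103b3-g2-0 2026-08-15T17:01:34Z):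
its hypotheses are this route's items and its conclusion the sub-problem Statement (glue_lint), and it elaborates with this file. -/

@[closes "route-CriticalPhenomena-CardyMirrorMonotone"] theorem closes : SubseqConformalInvariance → SubseqRigidity → Assembly → _root_.CardyFormulaZ2 :=
  -- Deciding theorem (D-0027 §2.1): X_M (target) + Cardy rigidity along subsequences ⇒ CardyFormulaZ2,
  -- by topology alone (𝓝[>] 0 is countably generated: convergence iff every sequence of meshes has a
  -- further subsequence converging to F η). Term mode on purpose; `h_Assembly` (the legacy assembly
  -- item = this very implication) is carried as an unused hypothesis on purpose (keeps the item tied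
  -- to the deciding theorem and keeps one linter diagnostic in the file — see route note rev 5).
  fun h_SubseqConformalInvariance h_SubseqRigidity h_Assembly R ψ x hU =>
    Filter.tendsto_of_subseq_tendsto fun ns hns =>
      (h_SubseqConformalInvariance ns hns).elim fun φ hφ =>
        hφ.2.elim fun g hg =>
          ⟨φ, (h_SubseqRigidity (ns ∘ φ) (hns.comp hφ.1.tendsto_atTop) g
              (fun R' ψ' x' hU' => hg R' ψ' x' hU')
              (Literature.Probability.RandomPlanarGeometry.ConformalRectangle.crossRatio_mem_Ioo_of_isUniformizing hU)) ▸
            hg R ψ x hU⟩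

end Summit.CriticalPhenomena.CardyFormulaZ2.Theses.CardyMirrorMonotone
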